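import Summits.CriticalPhenomena.PercolationContinuityZ3.Theorems.PercNearOneGluingNoHeavyPcintKingRouteBridgeS
import Summits.CriticalPhenomena.PercolationContinuityZ3.Theorems.PercNearOneGluingNoHeavyPcintTFibProcess
import HarnessLib

/-!
# PCINT lane, T-fibre route, step (6a): the triangular-lattice side of the box inequality as a `P_s`-probability

Cell `prim-pcint`, seat `prim-pcint-1` (gen 11); memo `run/shared/lean/prim/pcint/T-FIBRE-ROUTE.md` §6.

Bridge between the tree's site percolation measure and the finite sums of `AdaptDom`, for the triangular lattice
(the square-lattice version is `KingRoute.real_exitEvent_le_sum_wt_reach`, `…PcintKingRouteBridgeS.lean`, whose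
`propCfg` / `propCfgEquiv` / `siteWeight_propCfg` are reused): for a finite `Λ ⊆ ℤ²` containing the origin,

  `P_s(0 ⟷ ∂ⁱⁿΛ in Λ, by 𝕋-paths) ≤ Σ_{ω : Λ → Bool} π_s(ω) · reachIndicator (boxGraphT Λ) 0 B ω`,

where `B` is the set of sites of `Λ` on its inner boundary in `𝕋` (`TFib.real_exitEvent_le_sum_wt_reach`).
-/

noncomputable section

namespace Summit.CriticalPhenomena.PercolationContinuityZ3.Theorems.Pcint

namespace TFib

open Finset AdaptDom ClusterExpl KingRoute Literature.Probability.Percolation Literature.Probability.LatticeModels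

variable {Λ : Finset (Site 2)}

/-- **A configuration in the trace of the `𝕋`-exit event reaches the inner boundary inside `boxGraphT Λ`**: if the lift
of `propCfg ω` lies in `exitEvent triGraph Λ 0` then `reachIndicator (boxGraphT Λ) 0 B ω = 1` for `B` = the sites of
`Λ` on its inner `𝕋`-boundary. -/
theorem reachIndicator_eq_one_of_mem_traceEvent (h0 : (0 : Site 2) ∈ Λ) {ω : ↥Λ → Bool}
    (hω : propCfg Λ ω ∈ traceEvent Λ (exitEvent triGraph Λ 0)) :
    reachIndicator (boxGraphT Λ) ⟨0, h0⟩ (Λ.attach.filter fun v => v.1 ∈ innerBoundary triGraph Λ) ω = 1 := by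
  classical
  set C : Set (Site 2) := {v | liftSiteConfig Λ (propCfg Λ ω) v} with hC
  have hE : C ∈ exitEvent triGraph Λ 0 := hω
  obtain ⟨b, hb, hconn⟩ := mem_exitEvent_iff.1 hE
  have hpath : PathIn triGraph (↑Λ ∩ C) 0 b := PathIn.of_mem_siteConnIn hconn
  have key : ∀ {t : Site 2}, Relation.ReflTransGen (fun a c => triGraph.Adj a c ∧ c ∈ (↑Λ ∩ C : Set (Site 2))) 0 t →
      ∃ ht : t ∈ Λ, Relation.ReflTransGen (fun a c : ↥Λ => (boxGraphT Λ).Adj a c ∧ ω c = true) ⟨0, h0⟩ ⟨t, ht⟩ := by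
    intro t h
    induction h with
    | refl => exact ⟨h0, Relation.ReflTransGen.refl⟩
    | @tail u t _ hut ih =>
      obtain ⟨hu, hchain⟩ := ih
      obtain ⟨ht', hωt⟩ := (mem_liftSiteConfig_propCfg (ω := ω)).1 hut.2.2
      exact ⟨ht', hchain.tail ⟨(boxGraphT_adj Λ).2 hut.1, hωt⟩⟩
  have hbΛ : b ∈ Λ := (mem_innerBoundary_iff.1 hb).1
  have h0C : (0 : Site 2) ∈ (↑Λ ∩ C : Set (Site 2)) := hpath.left_mem
  obtain ⟨h0', hω0⟩ := (mem_liftSiteConfig_propCfg (ω := ω)).1 h0C.2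
  obtain ⟨hbΛ', hchain⟩ := key hpath.2
  have hopen : OpenPath (boxGraphT Λ) ⟨0, h0⟩ ω ⟨b, hbΛ⟩ := ⟨hω0, hchain⟩
  have hB : (⟨b, hbΛ⟩ : ↥Λ) ∈ Λ.attach.filter fun v => v.1 ∈ innerBoundary triGraph Λ :=
    mem_filter.2 ⟨mem_attach _ _, hb⟩
  unfold reachIndicator
  rw [if_pos ⟨_, hB, hopen⟩]

/-- **The triangular-lattice side of the box inequality**: `P_s(0 ⟷ ∂ⁱⁿΛ in Λ) ≤ E_{π_s}[reachIndicator]`. -/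
theorem real_exitEvent_le_sum_wt_reach (h0 : (0 : Site 2) ∈ Λ) (q : unitInterval) :
    (sitePercolation (Site 2) q).real (exitEvent triGraph Λ 0) ≤
      ∑ ω : ↥Λ → Bool, wt (q : ℝ) ω *
        reachIndicator (boxGraphT Λ) ⟨0, h0⟩ (Λ.attach.filter fun v => v.1 ∈ innerBoundary triGraph Λ) ω := by
  classical
  rw [sitePercolation_real_eq_sum q (determinedBy_exitEvent (G := triGraph) Λ 0)]
  set E := exitEvent triGraph Λ 0 with hE
  set B := Λ.attach.filter fun v => v.1 ∈ innerBoundary triGraph Λ with hB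
  have hwt : ∀ ω : ↥Λ → Bool, 0 ≤ wt (q : ℝ) ω := fun ω => wt_nonneg q.2.1 q.2.2 ω
  have hreach : ∀ ω : ↥Λ → Bool, 0 ≤ reachIndicator (boxGraphT Λ) ⟨0, h0⟩ B ω := by
    intro ω; unfold reachIndicator; split_ifs <;> norm_num
  calc _ = ∑ ω ∈ (univ.filter fun y : ↥Λ → Prop => y ∈ traceEvent Λ E).map (propCfgEquiv Λ).symm.toEmbedding,
        siteWeight q (propCfg Λ ω) := by
        rw [Finset.sum_map]
        refine Finset.sum_congr (by ext y; simp) fun y _ => ?_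
        have : propCfg Λ ((propCfgEquiv Λ).symm y) = y := (propCfgEquiv Λ).apply_symm_apply y
        rw [Equiv.coe_toEmbedding, this]
    _ = ∑ ω ∈ (univ.filter fun y : ↥Λ → Prop => y ∈ traceEvent Λ E).map (propCfgEquiv Λ).symm.toEmbedding,
        wt (q : ℝ) ω * reachIndicator (boxGraphT Λ) ⟨0, h0⟩ B ω := by
        refine Finset.sum_congr rfl fun ω hω => ?_
        rw [Finset.mem_map] at hω
        obtain ⟨y, hy, rfl⟩ := hω
        have hy' : y ∈ traceEvent Λ E := (mem_filter.1 hy).2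
        have hpc : propCfg Λ ((propCfgEquiv Λ).symm.toEmbedding y) = y := (propCfgEquiv Λ).apply_symm_apply y
        rw [siteWeight_propCfg, reachIndicator_eq_one_of_mem_traceEvent h0 (by rw [hpc]; exact hy'), mul_one]
    _ ≤ ∑ ω, wt (q : ℝ) ω * reachIndicator (boxGraphT Λ) ⟨0, h0⟩ B ω :=
        Finset.sum_le_sum_of_subset_of_nonneg (Finset.subset_univ _) fun ω _ _ => mul_nonneg (hwt ω) (hreach ω)

end TFib

end Summit.CriticalPhenomena.PercolationContinuityZ3.Theorems.Pcint

end
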